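import Summits.ResolutionOfSingularities.ResolutionOfSingularities.Theorems.EquisingularLiftEquisingularLiftNatTowerRoundThreeDefs
import Literature.AlgebraicGeometry.Resolution.QuasiRegularSequences
import Mathlib.AlgebraicGeometry.Morphisms.Proper
import Mathlib.AlgebraicGeometry.Morphisms.Flat
import HarnessLib

/-!
# Route `EquisingularLift`, crux EL♮ (stmt-ResolutionOfSingularities-20038) / EL♮(3) (stmt-…-20148) — rung TOWER, revision ₅:
# RATIONAL MULTISECTION ROUNDS admitted on the intrinsic clause `DirStepUnobs`, and the hypothesis-residue (T-k) `EmbeddedCurveLift`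
# — append-only successor of …NatTowerRoundThreeDefs (p567373)

res-L1-w45b-lead-2 g4 (lead, text owner), NINETEENTH registered-text event (the split of the research residue
`stub_elnat_three_isolated_nonConeTower`, LEAD WORDS 2026-08-28T01:33Z / 01:39Z on res-type-027's RESIDUE-1 census faf4aafedf11a66b).
OURS; planning vocabulary of the crux chain, not a statement of any manuscript ([Hironaka2017] is a candidate under adjudication, D-0012/D-0089,
nothing of it is asserted here); AI-written, weaker than expert review. Definitions + pure-logic lemmas only (no `sorry`, standard axioms).

WHY. Revisions ₃/₄ hoisted `DirStepSec` («the centre is a SECTION of the running exceptional ruled surface») in front of every Čech-witnessed round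
because the upstairs SUPPLIER of the round — the (L) socket `stub_elnat_three_liftSections` (res-L1-w45b-stub-4 p593434, route C: direction sections +
T-P1VB + the Euler identification (★)) — lifts SECTIONS. The unobstructedness clause itself, `DirStepUnobs G E hE Z hZ` = «`H¹(Z̃, 𝒩_{Z̃/Ẽ}) = 0`», is
INTRINSIC to the pair `Z̃ ⊆ Ẽ` and is the published unobstructedness for embedded deformations of ANY local complete intersection `Z̃ ⊆ Ẽ = (E_O)_k`
(Hartshorne, *Deformation Theory* (2010), Thm. 6.2 / Thm. 22.3 — typed in the tree for the `ℙ^r` case as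
`Literature.AlgebraicGeometry.Deformation.EmbeddedLiftingVanishingNormalH1.Hartshorne2010_thm_22_3`; Kollár, *Rational Curves* I.2.10): given
`H¹(𝒩) = 0`, the curve lifts to an `O`-flat closed subscheme of the `O`-smooth proper surface `E_O`, whatever its degree over the carrier. A CONSUMER
clause in T-P1VB's currency («`H¹(Z̃, 𝓗om(L₀, Q)) = 0`» = `H¹` of the relative tangent sheaf of the RULING restricted to `Z̃`) is NOT expressible
in `TowerRound`'s variables for later exceptional surfaces (their ruling base is not in the stage tuple), and for multisections it is strictly
STRONGER than `DirStepUnobs` (res-type-027 census (b)(ii): by `deg R_φ = 2d − 2`). Hence revision ₅: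

* `TowerRound₄` — `TowerRound₃` whose admission, after `TowerFull`, is
  `(DirStepSec ∧ (Čech₃ ∨ ConeWitness)) ∨ (IsIrreducible Z ∧ RationalCarrier Z̃ ∧ G regular along Z̃ ∧ Ẽ regular along Z̃ ∧ DirStepUnobs)`:
  the old section rounds VERBATIM, plus Čech rounds along IRREDUCIBLE RATIONAL MULTISECTIONS of any degree (separable or not) of the running
  exceptional surface — the rounds the ₄ texts excluded (census (T-i)/(T-j) at `Γ̃ ≅ ℙ¹`). The cone disjunct keeps `DirStepSec` (RULING-8 (α):
  the doubled-shadow countermodel had a REDUCIBLE cone-witnessed centre; here irreducibility is explicit on the new disjunct). `RationalCarrier Z̃`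
  keeps every later carrier rational (the next exceptional surface is ruled over `Z̃`), so `RationalCarrierLift` (T-j) still governs the carriers.
* `ReachTower₅` / `ReachNoseTower₅` — the ₄ reach predicates with `TowerRound₄`; `towerRound₃_of_towerRound₄`, `reachTower₅_of_reachTower₄`,
  `reachNoseTower₅_of_reachNoseTower₄` (₄ ⊆ ₅, pure logic).
* `EmbeddedCurveLiftAt` / `EmbeddedCurveLift O k θ P q` / `EmbeddedCurveLiftFact` — the hypothesis-residue (T-k) «embedded curves with
  `H¹(𝒩) = 0` on the special fibre of a regular `O`-flat proper surface lift to regular `O`-flat curves with the prescribed reduced trace», in the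
  chain's vocabulary (model square, `IdealSheafData.comap`, `Flat`, `IsProper`, quasi-regular 2-frames of the lifted centre for the next round's
  root data), typed next to `RationalCarrierLift` (T-j). Consumed ONLY as a hypothesis: the new rung stub is `EmbeddedCurveLiftFact → …`, and
  `EmbeddedCurveLiftFact` itself is registered as a stub (NEED-FACT), so that the composition stays honest about what is used.

References (index only, no claim typed from them here): R. Hartshorne, *Deformation Theory*, GTM 257 (2010), Thm. 6.2, Thm. 22.3 (tree:
`Literature.AlgebraicGeometry.Deformation.EmbeddedLiftingVanishingNormalH1`); J. Kollár, *Rational Curves on Algebraic Varieties* (1996), Thm. I.2.10;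
A. Grothendieck, FGA 221 (Hilbert schemes).
-/

set_option linter.dupNamespace false

noncomputable section

open CategoryTheory AlgebraicGeometry TopologicalSpace
open Literature.AlgebraicGeometry.Resolution
open AlgebraicGeometry.Scheme.IdealSheafData

namespace Summit.ResolutionOfSingularities.ResolutionOfSingularities.Cruxes.EquisingularLiftNat.Sections

/-! ### Revision ₅ of the round constructor and the reach predicate -/

/-- **TOWER / (round), revision ₄ — rational multisection rounds admitted.** `TowerRound₃` (all binders and the stage update verbatim) whose
admission is: EITHER the ₃ admission `DirStepSec ∧ (Čech ∨ ConeWitness)` (section rounds, unchanged) OR the NEW Čech disjunct along an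
IRREDUCIBLE RATIONAL MULTISECTION: `IsIrreducible Z`, `RationalCarrier Z̃` (`Z̃ ≅ ℙ¹` over some field — regular, any degree over the carrier,
separable or not), the ambient `G` and the reduced surface `Ẽ` regular along `Z̃`, and `DirStepUnobs G E hE Z hZ` (`H¹(Z̃, 𝒩_{Z̃/Ẽ}) = 0`).
Downstairs only. [OURS · planning vocabulary] -/
def TowerRound₄ (F₉ F₁₀ : Scheme.{0}) (υ' : F₁₀ ⟶ F₉) (Z₉ : Set F₉) (hZ₉ : IsClosed Z₉)
    (R₁ : ∀ G : Scheme.{0}, (G ⟶ F₁₀) → Set G → Set G → Set G → Prop) : Prop :=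
  ∀ (G G' : Scheme.{0}) (γ : G ⟶ F₁₀) (T E K : Set G) (hE : IsClosed E) (Z : Set G) (hZ : IsClosed Z) (υ₂ : G' ⟶ G) (K' : Set G'),
    R₁ G γ T E K →
    Z ⊆ E ∩ T → Z.Nonempty →
    TowerFull F₉ F₁₀ υ' Z₉ hZ₉ G γ Z hZ →
    ((DirStepSec F₉ F₁₀ υ' Z₉ hZ₉ G γ Z hZ ∧
        ((RationalCarrier (redSub F₉ Z₉ hZ₉) ∧
            (∀ x : redSub G Z hZ, IsRegularLocalRing (G.presheaf.stalk (redSubι G Z hZ x))) ∧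
            (∀ (i : redSub G Z hZ ⟶ redSub G E hE), i ≫ redSubι G E hE = redSubι G Z hZ →
              ∀ x : redSub G Z hZ, IsRegularLocalRing ((redSub G E hE).presheaf.stalk (i x))) ∧
            DirStepUnobs G E hE Z hZ) ∨
          ConeWitness G E hE K Z hZ)) ∨
      (IsIrreducible Z ∧ RationalCarrier (redSub G Z hZ) ∧
        (∀ x : redSub G Z hZ, IsRegularLocalRing (G.presheaf.stalk (redSubι G Z hZ x))) ∧
        (∀ (i : redSub G Z hZ ⟶ redSub G E hE), i ≫ redSubι G E hE = redSubι G Z hZ →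
          ∀ x : redSub G Z hZ, IsRegularLocalRing ((redSub G E hE).presheaf.stalk (i x))) ∧
        DirStepUnobs G E hE Z hZ)) →
    IsBlowup υ₂ (Scheme.IdealSheafData.vanishingIdeal (⟨Z, hZ⟩ : Closeds G)) →
    (K' = ∅ ∨ ((ConeWitness G E hE K Z hZ ∨ closure (Z \ closure K) = Z) ∧ K' = closure (υ₂ ⁻¹' (K \ Z)))) →
    R₁ G' (υ₂ ≫ γ) (closure (υ₂ ⁻¹' (T \ Z))) (υ₂ ⁻¹' Z) K' ∧
      R₁ G' (υ₂ ≫ γ) (closure (υ₂ ⁻¹' (T \ Z))) (closure (υ₂ ⁻¹' (E \ Z))) K'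

/-- **ReachTower₅** — `ReachTower₄` with `TowerRound₄` (rational multisection rounds admitted). Downstairs only; K5′'s `Reach` slot.
[OURS · planning vocabulary] -/
def ReachTower₅ (F₁ F₂ : Scheme.{0}) (υ : F₂ ⟶ F₁) (x : F₁) (T₂ : Set F₂) (F' : Scheme.{0}) (β : F' ⟶ F₂) (T' : Set F') : Prop :=
  ∃ (W : Set F₁) (K₂ : Set F₂) (F₉ : Scheme.{0}) (β₉ : F₉ ⟶ F₂) (T₉ Z₉ K₉ : Set F₉) (b₉ : Bool) (hZ₉ : IsClosed Z₉)
    (F₁₀ : Scheme.{0}) (υ' : F₁₀ ⟶ F₉) (γ' : F' ⟶ F₁₀) (E' K' : Set F'),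
    x ∈ W ∧ ¬ (υ ⁻¹' {x} ⊆ closure (υ ⁻¹' (W \ {x}))) ∧
    (∃ U : F₁.affineOpens, x ∈ (U : F₁.Opens) ∧
      ((Scheme.IdealSheafData.vanishingIdeal (⟨closure W, isClosed_closure⟩ : Closeds F₁)).ideal U).IsPrincipal) ∧
    υ ⁻¹' {x} ∩ closure (υ ⁻¹' (W \ {x})) ⊆ T₂ ∧
    (K₂ = ∅ ∨ (ConeForm F₁ x W ∧ K₂ = closure (υ ⁻¹' (W \ {x})))) ∧
    InCarrierReachK F₂ T₂ (υ ⁻¹' {x} ∩ closure (υ ⁻¹' (W \ {x}))) K₂ F₉ β₉ T₉ Z₉ K₉ b₉ ∧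
    Z₉ ⊆ T₉ ∧ ¬ (T₉ ⊆ Z₉) ∧ Z₉.Infinite ∧
    Set.Finite {z : redSub F₉ Z₉ hZ₉ | ¬ IsRegularLocalRing ((redSub F₉ Z₉ hZ₉).presheaf.stalk z)} ∧
    IsBlowup υ' (Scheme.IdealSheafData.vanishingIdeal (⟨Z₉, hZ₉⟩ : Closeds F₉)) ∧
    (∀ R₁ : (∀ G : Scheme.{0}, (G ⟶ F₁₀) → Set G → Set G → Set G → Prop),
      R₁ F₁₀ (𝟙 F₁₀) (closure (υ' ⁻¹' (T₉ \ Z₉))) (υ' ⁻¹' Z₉) (closure (υ' ⁻¹' (K₉ \ Z₉))) →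
      TowerPtReg₂ F₉ F₁₀ υ' R₁ → TowerPtRam₂ F₉ F₁₀ υ' R₁ → TowerRound₄ F₉ F₁₀ υ' Z₉ hZ₉ R₁ → R₁ F' γ' T' E' K') ∧
    β = (γ' ≫ υ') ≫ β₉

/-- Closure under `₄`-rounds implies closure under `₃`-rounds (the `₃` rounds are among the `₄` rounds). [OURS · pure logic] -/
theorem towerRound₃_of_towerRound₄ (F₉ F₁₀ : Scheme.{0}) (υ' : F₁₀ ⟶ F₉) (Z₉ : Set F₉) (hZ₉ : IsClosed Z₉)
    (R₁ : ∀ G : Scheme.{0}, (G ⟶ F₁₀) → Set G → Set G → Set G → Prop) (h : TowerRound₄ F₉ F₁₀ υ' Z₉ hZ₉ R₁) :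
    TowerRound₃ F₉ F₁₀ υ' Z₉ hZ₉ R₁ := by
  intro G G' γ T E K hE Z hZ υ₂ K' hR hZET hne hfull hsec hadm hυ₂ hK'
  exact h G G' γ T E K hE Z hZ υ₂ K' hR hZET hne hfull (Or.inl ⟨hsec, hadm⟩) hυ₂ hK'

/-- **TOWER₄ ⊆ TOWER₅**: every ₄-chain is a ₅-chain (the closure hypothesis on `R₁` only gets stronger). [OURS · pure logic] -/
theorem reachTower₅_of_reachTower₄ (F₁ F₂ : Scheme.{0}) (υ : F₂ ⟶ F₁) (x : F₁) (T₂ : Set F₂) (F' : Scheme.{0}) (β : F' ⟶ F₂)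
    (T' : Set F') (h : ReachTower₄ F₁ F₂ υ x T₂ F' β T') : ReachTower₅ F₁ F₂ υ x T₂ F' β T' := by
  obtain ⟨W, K₂, F₉, β₉, T₉, Z₉, K₉, b₉, hZ₉, F₁₀, υ', γ', E', K', h1, h2, h3, h4, h5, h6, h7, h8, h9, h10, h11, hcl, hβ⟩ := h
  exact ⟨W, K₂, F₉, β₉, T₉, Z₉, K₉, b₉, hZ₉, F₁₀, υ', γ', E', K', h1, h2, h3, h4, h5, h6, h7, h8, h9, h10, h11,
    fun R₁ hseed hreg hram hround => hcl R₁ hseed hreg hram (towerRound₃_of_towerRound₄ F₉ F₁₀ υ' Z₉ hZ₉ R₁ hround), hβ⟩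

/-- **NOSE-TOWER, revision ₅** — `ReachNoseTower₄` with `TowerRound₄` (rational multisection rounds admitted). Downstairs only; typed now so
that a later split of the non-isolated residue needs no new definitions. [OURS · planning vocabulary] -/
def ReachNoseTower₅ (k : Type) [Field k] (n : ℕ) (H : Scheme.{0})
    (ι : H ⟶ (Literature.AlgebraicGeometry.Motives.projectiveSpace n k).left) : Prop :=
  ∃ (Z : Set (Literature.AlgebraicGeometry.Motives.projectiveSpace n k).left) (hZ : IsClosed Z),
    IsLiftableNoseClass₂ k n Z ∧ Z ⊆ Set.range ι ∧ ¬ (Set.range ι ⊆ Z) ∧ Z.Infinite ∧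
    Nonempty (redSub (Literature.AlgebraicGeometry.Motives.projectiveSpace n k).left Z hZ ≅
      (Literature.AlgebraicGeometry.Motives.projectiveSpace 1 k).left) ∧
    ∃ (F₂ : Scheme.{0}) (υ : F₂ ⟶ (Literature.AlgebraicGeometry.Motives.projectiveSpace n k).left),
      IsBlowup υ (Scheme.IdealSheafData.vanishingIdeal
        (⟨Z, hZ⟩ : Closeds (Literature.AlgebraicGeometry.Motives.projectiveSpace n k).left)) ∧
      ∃ (F' : Scheme.{0}) (γ' : F' ⟶ F₂) (T' E' K' : Set F'),
        (∀ R₁ : (∀ G : Scheme.{0}, (G ⟶ F₂) → Set G → Set G → Set G → Prop),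
          R₁ F₂ (𝟙 F₂) (closure (υ ⁻¹' (Set.range ι \ Z))) (υ ⁻¹' Z) ∅ →
          TowerPtReg₂ (Literature.AlgebraicGeometry.Motives.projectiveSpace n k).left F₂ υ R₁ →
          TowerPtRam₂ (Literature.AlgebraicGeometry.Motives.projectiveSpace n k).left F₂ υ R₁ →
          TowerRound₄ (Literature.AlgebraicGeometry.Motives.projectiveSpace n k).left F₂ υ Z hZ R₁ →
          R₁ F' γ' T' E' K') ∧
        Literature.AlgebraicGeometry.Resolution.Scheme.IsRegular (redSub F' (closure T') isClosed_closure)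

/-- **NOSE₄ ⊆ NOSE₅** (forgetful). [OURS · pure logic] -/
theorem reachNoseTower₅_of_reachNoseTower₄ (k : Type) [Field k] (n : ℕ) (H : Scheme.{0})
    (ι : H ⟶ (Literature.AlgebraicGeometry.Motives.projectiveSpace n k).left) (h : ReachNoseTower₄ k n H ι) :
    ReachNoseTower₅ k n H ι := by
  obtain ⟨Z, hZ, h1, h2, h3, h4, h5, F₂, υ, hυ, F', γ', T', E', K', hcl, hreg⟩ := h
  exact ⟨Z, hZ, h1, h2, h3, h4, h5, F₂, υ, hυ, F', γ', T', E', K',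
    fun R₁ hseed hreg' hram hround => hcl R₁ hseed hreg' hram (towerRound₃_of_towerRound₄ _ F₂ υ Z hZ R₁ hround), hreg⟩

/-! ### The hypothesis-residue (T-k): embedded curves with `H¹(𝒩) = 0` lift -/

/-- **`EmbeddedCurveLiftAt O k θ X σ q 𝓔` — residue (T-k) at ONE exceptional surface.** For the stage `σ : X ⟶ P` over `q : P ⟶ Spec O`
(`X` regular, locally Noetherian, integral) and a closed subscheme `V(𝓔) ⊆ X` (the running exceptional surface upstairs: regular, flat and proper over
`Spec O`): whenever `(j, t)` is a model square of `X` over the residue map `θ : O → k`, `E ⊆ G` is closed with EXACT REDUCED trace `𝓔·𝒪_G = 𝓘⟨E⟩`,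
and `Z ⊆ E` is closed with `Z̃` regular, `Ẽ` regular along `Z̃` and UNOBSTRUCTED embedded deformations in `Ẽ` (`DirStepUnobs`: `H¹(Z̃, 𝒩_{Z̃/Ẽ}) = 0`),
there is a centre `C ⊇`-wise inside `V(𝓔)` (`𝓔 ≤ C`), regular, flat over `Spec O`, with exact reduced trace `C·𝒪_G = 𝓘⟨Z⟩`, whose stalk ideals
are generated by quasi-regular pairs WHERE `V(C)` has codimension 2 (the next round's root data (R3); stated under the codimension hypothesis so
that the fact stays true in every relative dimension). Informal route: the local Hilbert functor of `Z̃ ⊆ Ẽ` in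
`V(𝓔)/O` is smooth when `H¹(𝒩) = 0` (tree: `Deformation.EmbeddedDeformationsVanishingNormalH1`), Hensel over the complete `O`, Grothendieck
existence for the proper `V(𝓔)`; regularity of `C` from flatness + regular special fibre; two quasi-regular generators from regular-in-regular of
codimension 2. [OURS · L1 W4.5b · residue (T-k)] (Hartshorne 2010, Thm. 22.3; Kollár 1996, Thm. I.2.10 — index only); consumed ONLY as a hypothesis;
NOT a statement of the manuscript. -/
def EmbeddedCurveLiftAt (O : Type) [CommRing O] (k : Type) [Field k] (θ : O →+* k) {P : Scheme.{0}}
    (X : Scheme.{0}) (σ : X ⟶ P) (q : P ⟶ Spec (.of O)) (𝓔 : X.IdealSheafData) : Prop :=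
  IsIntegral X → IsLocallyNoetherian X → Scheme.IsRegular X →
  Scheme.IsRegular 𝓔.subscheme → Flat (𝓔.subschemeι ≫ σ ≫ q) → IsProper (𝓔.subschemeι ≫ σ ≫ q) →
  ∀ (G : Scheme.{0}) (j : G ⟶ X) (t : G ⟶ Spec (.of k)),
    IsPullback j t (σ ≫ q) (Spec.map (CommRingCat.ofHom θ)) →
    ∀ (E : Set G) (hE : IsClosed E), 𝓔.comap j = vanishingIdeal (⟨E, hE⟩ : Closeds G) →
    ∀ (Z : Set G) (hZ : IsClosed Z), Z ⊆ E →
      (∀ x : redSub G Z hZ, IsRegularLocalRing ((redSub G Z hZ).presheaf.stalk x)) →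
      (∀ (i : redSub G Z hZ ⟶ redSub G E hE), i ≫ redSubι G E hE = redSubι G Z hZ →
        ∀ x : redSub G Z hZ, IsRegularLocalRing ((redSub G E hE).presheaf.stalk (i x))) →
      DirStepUnobs G E hE Z hZ →
      ∃ C : X.IdealSheafData, 𝓔 ≤ C ∧ Scheme.IsRegular C.subscheme ∧ Flat (C.subschemeι ≫ σ ≫ q) ∧
        C.comap j = vanishingIdeal (⟨Z, hZ⟩ : Closeds G) ∧
        ∀ x ∈ C.support, ringKrullDim (X.presheaf.stalk x ⧸ stalkIdeal C x) + 2 = ringKrullDim (X.presheaf.stalk x) →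
          ∃ c : Fin 2 → X.presheaf.stalk x, Ideal.span (Set.range c) = stalkIdeal C x ∧ IsQuasiRegular c

/-- **`EmbeddedCurveLift O k θ P q` — residue (T-k) for the WHOLE tower over `q : P ⟶ Spec O`**: `EmbeddedCurveLiftAt` at every stage and
every exceptional surface. [OURS · L1 W4.5b · residue (T-k)]; hypothesis-only; NOT a statement of the manuscript. -/
def EmbeddedCurveLift (O : Type) [CommRing O] (k : Type) [Field k] (θ : O →+* k) (P : Scheme.{0}) (q : P ⟶ Spec (.of O)) : Prop :=
  ∀ (X : Scheme.{0}) (σ : X ⟶ P) (𝓔 : X.IdealSheafData), EmbeddedCurveLiftAt O k θ X σ q 𝓔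

/-- **`EmbeddedCurveLiftFact` — (T-k) closed over every base the chain may choose**: for every algebraically closed field `k`, every adically
complete discrete valuation ring `O` with a surjection `θ : O → k`, and every `P` over `Spec O`, `EmbeddedCurveLift O k θ P q`. This is the NEED-FACT
the NINETEENTH registration isolates (registered as its own stub); it is the tree-vocabulary form of «local complete intersection curves with
`H¹(𝒩) = 0` on the special fibre of a flat proper `O`-scheme lift» (Hartshorne 2010, Thm. 22.3; Kollár 1996, Thm. I.2.10 — index only).
[OURS · L1 W4.5b · residue (T-k)]; hypothesis-only; NOT a statement of the manuscript. -/
def EmbeddedCurveLiftFact : Prop :=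
  ∀ (k : Type) [Field k] [IsAlgClosed k] (O : Type) [CommRing O] [IsDomain O] [IsDiscreteValuationRing O]
    [IsAdicComplete (IsLocalRing.maximalIdeal O) O] (θ : O →+* k), Function.Surjective θ →
    ∀ (P : Scheme.{0}) (q : P ⟶ Spec (.of O)), EmbeddedCurveLift O k θ P q

end Summit.ResolutionOfSingularities.ResolutionOfSingularities.Cruxes.EquisingularLiftNat.Sections

end
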